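import Summits.QuantumFields.BalabanUV.Beta.SpineRecursiveWLawComb

/-!
# `BalabanUV.Beta.SpineRecursiveT2AllComb` — binder row D1, RULING R-D1-g35-1 (chart (III′)), brick P6-4: **THE SECOND-ORDER LETTER LAW (hT2-rem) AT EVERY LEVEL BY
# INDUCTION, FOR THE SLOTTED TABLES AT THE COMB-CHART RESOLVENTS** — the (III′) twin of `SpineRecursiveT2AllSym` (gen 31, (N7c-ii)): `loc_WRem_comb`,
# **`T2RecOf_bref_all_of_letters_comb`** — induction on the level with step = `SpineRecursiveWLawComb.WrecOf_bref_of_T2RM_comb` then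
# `SpineRecursiveT2StepComb.T2RecOf_succ_bref_of_laws_comb`; `Gsym ↦ GcombSh`, `Dsh ↦ Dsh Lc` (shift letters are theorems, not displayed)

HONEST FRAMING (cell charter, verbatim): «discharging BetaPertH makes Bałaban's UV stability UNCONDITIONAL — a real constructive-QFT result; it is
NOT the continuum limit and NOT the Clay problem.»  HONEST DEPENDENCY: continuum YM on T⁴ ⇐ BetaPertH ∧ nine spine estimates (0/9 proved); BetaPertH
⇐ (D1) ∧ (D4) ∧ CAP+tail; G-an2-4 gates asym, D1 and NE2/3/4.  DERIVED cell leaf (wiring, [folklore]; β sub-cell, row-D1 OWNER `b2b-balaban-beta-an2` gen 36, programme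
P6); no statement of Bałaban's papers, no `[cite:]`, no `def`, no `Prop` fact; EVERY table LETTER IS A HYPOTHESIS; instantiates no binder of the wall.  RECORD = ROOT M′
p303989 (chart (II)) unchanged.  NOT D1, NOT `BetaPertH`, NOT continuum, NOT Clay.
Provenance: β sub-cell, unit beta-an2 gen 36, 2026-08-22 (v1); text of `SpineRecursiveT2AllSym` transformed by name; no existing file touched.
-/

open Finset
open scoped BigOperators
open Literature.Probability.LatticeModels (Torus.proj)
open Literature.MathematicalPhysics.QuantumFieldTheory
open Literature.MathematicalPhysics.QuantumFieldTheory.Balaban1983to89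
open Literature.MathematicalPhysics.QuantumFieldTheory.Balaban1983to89.Beta
open ExpKernelCalculus (MKer Decays BiLoc comp VertexFamily)
open PolarizationSign (reflSign)
open KernelReflection (refK)
open ResolventReflection (bref Φ)
open OneStepResolventKernel (Fib LocStencil)
open OneStepKernelFamily (KInvStep colH)
open BalabanStepJetsSucc (mmRead wE wVH)
open BalabanStepW2 (M2Of wV4 wB2)
open BalabanCompositeJets (LocStencil₂)
open SecondOrderResponse (dM W2OfK LocStencilFM)
open Summit.QuantumFields.BalabanUV.Beta.TameKernelCalculus
open Summit.QuantumFields.BalabanUV.Beta.ChartConjugation (conjV conjW loc_conjV)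
open Summit.QuantumFields.BalabanUV.Beta.BorderedHessian (bhK diagK diagK_apply stepScale)
open Summit.QuantumFields.BalabanUV.Beta.SymSliceProjectorKernel (symEc)
open Summit.QuantumFields.BalabanUV.Beta.WardLocusCubic (mmSym)
open Summit.QuantumFields.BalabanUV.Beta.ChartConjugationDefectEnd (sandwichDefect)
open Summit.QuantumFields.BalabanUV.Beta.CombChartStepJets (GcombSh)
open Summit.QuantumFields.BalabanUV.Beta.DshAn1 (Dsh spr_Dsh)
open Summit.QuantumFields.BalabanUV.Beta.SymShiftedSpread (bhKStepSh spr_bhKStepSh)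
open Summit.QuantumFields.BalabanUV.Beta.E3ContactGenerator (ctGenM)
open Summit.QuantumFields.BalabanUV.Beta.SecondOrderSymContact (loc_rem)

open Summit.QuantumFields.BalabanUV.Beta.AxialDressingRooted (one_le_of_neZero)

noncomputable section

namespace Summit.QuantumFields.BalabanUV.Beta.SpineRooted

section AllComb

variable {d Lc : ℕ} [NeZero Lc]

/-- [folklore] **THE W-REMAINDER AT THE SHIFTED SPREAD IS LOCALISED** (given `Loc (diagK X2s)`, `Loc Δ`, (Dspr)). -/
theorem loc_WRem_comb {j : ℕ}
    {X2s : Fin (d + 1) → (Fin (d + 1) → ℤ) → Fin (d + 1) → (Fin (d + 1) → ℤ) → (Fin (d + 1) → ℤ) → Fib d → ℝ}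
    {Δ : Fin (d + 1) → (Fin (d + 1) → ℤ) → Fin (d + 1) → (Fin (d + 1) → ℤ) → MKer (d + 1) (Fib d)}
    (hX2L : ∀ μ y ν y', Loc (diagK (X2s μ y ν y'))) (hΔL : ∀ μ y ν y', Loc (Δ μ y ν y')) (μ : Fin (d + 1)) (y : Fin (d + 1) → ℤ) (ν : Fin (d + 1))
    (y' : Fin (d + 1) → ℤ) :
    Loc ((1 / 2 : ℝ) • conjV (bhKStepSh d Lc (Dsh Lc) j) (diagK fun p a => X2s ν y' μ y p a - X2s μ y ν y' p a) +
      (1 / 2 : ℝ) • (Δ μ y ν y' + Δ ν y' μ y)) := by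
  have e : (diagK fun p a => X2s ν y' μ y p a - X2s μ y ν y' p a) = diagK (X2s ν y' μ y) - diagK (X2s μ y ν y') := by
    funext x z a b
    rw [Pi.sub_apply, Pi.sub_apply, Pi.sub_apply, Pi.sub_apply, diagK_apply, diagK_apply, diagK_apply]
    split_ifs <;> ring
  have hdiff : Loc (diagK fun p a => X2s ν y' μ y p a - X2s μ y ν y' p a) := by
    rw [e]; exact (hX2L ν y' μ y).sub (hX2L μ y ν y')
  exact loc_rem (loc_conjV (spr_bhKStepSh (spr_Dsh (one_le_of_neZero Lc)) j) hdiff) (hΔL μ y ν y') (hΔL ν y' μ y)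

/-- [folklore] **(hT2-rem) AT EVERY LEVEL FOR THE SLOTTED TABLES AT THE SYMMETRISED RESOLVENTS, BY INDUCTION FROM THE LETTERS** (see the module docstring;
every letter is a hypothesis; the remainder `R2` is DEFINED by the user through (hR2succ)). -/
theorem T2RecOf_bref_all_of_letters_comb (hLc : Odd Lc)
    {V H : Fin (d + 1) → (Fin (d + 1) → ℤ) → MKer (d + 1) (Fib d)}
    (hV : ∀ δ : ℝ, 0 ≤ δ → ∃ C : ℝ, LocStencil V C δ) (hH : ∀ δ : ℝ, 0 ≤ δ → ∃ C : ℝ, VertexFamily H Lc C δ)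
    (hV0 : ∀ (κ : Fin (d + 1)) (w x z : Fin (d + 1) → ℤ) (β β' : Fin (d + 1)), V κ w x z (Sum.inl β) (Sum.inl β') = 0)
    (hHr : ∀ (α μ : Fin (d + 1)) (y : Fin (d + 1) → ℤ), H μ (bref α μ y) = reflSign α μ • refK (Φ (d := d) Lc α) (H μ y))
    (cE cVH cΛ cE₂ cB : ℝ) (T : Fin 4 → Fin 4 → Fin 4 → Fin 4 → ℝ)
    {vh₂S : Fin (d + 1) → (Fin (d + 1) → ℤ) → Fin (d + 1) → (Fin (d + 1) → ℤ) → MKer (d + 1) (Fib d)} (hB2 : ∃ C δ : ℝ, 0 < δ ∧ LocStencil₂ vh₂S C δ)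
    (hB0 : ∀ κ u κ' u' (x z : Fin (d + 1) → ℤ) (β β' : Fin (d + 1)), vh₂S κ u κ' u' x z (Sum.inl β) (Sum.inl β') = 0)
    {mixFF : Fin (d + 1) → (Fin (d + 1) → ℤ) → Fin (d + 1) → (Fin (d + 1) → ℤ) → MKer (d + 1) (Fib d)} (hmix : ∃ C δ : ℝ, 0 < δ ∧ LocStencilFM Lc mixFF C δ)
    (γ : ℕ → ℝ)
    (hlock : ∀ j, cE * wE d Lc (j + 1) * (γ j / (stepScale d Lc j * (Lc : ℝ) ^ (d + 1))) / wVH d Lc (j + 1) = γ (j + 1))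
    (hlock2 : ∀ j, cE₂ * wV4 d Lc (j + 1) * wVH d Lc (j + 1) = (cE * wE d Lc (j + 1)) ^ 2)
    (hSp : ∀ (j : ℕ) (α κ : Fin (d + 1)) (u : Fin (d + 1) → ℤ), SpureRecOf d Lc V H (GcombSh Lc) cE cVH cΛ j κ (bref α κ u) = reflSign α κ • refK (Φ Lc α)
      (SpureRecOf d Lc V H (GcombSh Lc) cE cVH cΛ j κ u + conjV (bhKStepSh d Lc (Dsh Lc) j) (diagK fun p c => γ j * ctGenM d (bhK Lc + Dsh Lc) α Lc κ u p c)))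
    (h : ℕ → Fin (d + 1) → Fin (d + 1) → (Fin (d + 1) → ℤ) → Fin (d + 1) → (Fin (d + 1) → ℤ) → (Fin (d + 1) → ℤ) → Fib d → ℝ)
    (R2 : ℕ → Fin (d + 1) → Fin (d + 1) → (Fin (d + 1) → ℤ) → Fin (d + 1) → (Fin (d + 1) → ℤ) → MKer (d + 1) (Fib d))
    (RM : ℕ → Fin (d + 1) → Fin (d + 1) → (Fin (d + 1) → ℤ) → Fin (d + 1) → (Fin (d + 1) → ℤ) → MKer (d + 1) (Fib d))
    (h0 : ∀ (α κ : Fin (d + 1)) (u : Fin (d + 1) → ℤ) (κ' : Fin (d + 1)) (u' : Fin (d + 1) → ℤ),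
      T2RecOf d Lc (GcombSh Lc) (SpureRecOf d Lc V H (GcombSh Lc) cE cVH cΛ) (M1Of d Lc H cΛ) cE₂ cB T vh₂S mixFF 0 κ (bref α κ u) κ' (bref α κ' u') =
        (reflSign α κ * reflSign α κ') • refK (Φ Lc α)
          (T2RecOf d Lc (GcombSh Lc) (SpureRecOf d Lc V H (GcombSh Lc) cE cVH cΛ) (M1Of d Lc H cΛ) cE₂ cB T vh₂S mixFF 0 κ u κ' u' +
            conjW (bhKStepSh d Lc (Dsh Lc) 0) (SpureRecOf d Lc V H (GcombSh Lc) cE cVH cΛ 0 κ u) (SpureRecOf d Lc V H (GcombSh Lc) cE cVH cΛ 0 κ' u')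
              (diagK fun p c => γ 0 * ctGenM d (bhK Lc + Dsh Lc) α Lc κ u p c) (diagK fun p c => γ 0 * ctGenM d (bhK Lc + Dsh Lc) α Lc κ' u' p c) (diagK (h 0 α κ u κ' u')) +
            R2 0 α κ u κ' u'))
    (hM2 : ∀ (j : ℕ) (α κ : Fin (d + 1)) (u : Fin (d + 1) → ℤ) (ρ : Fin (d + 1)) (w : Fin (d + 1) → ℤ),
      M2Of d Lc mixFF j κ (bref α κ u) ρ (bref α ρ w) =
        (reflSign α κ * reflSign α ρ) • refK (Φ Lc α)
          (M2Of d Lc mixFF j κ u ρ w + conjV (M1Of d Lc H cΛ j ρ w) (diagK fun p c => γ j * ctGenM d (bhK Lc + Dsh Lc) α Lc κ u p c) + RM j α κ u ρ w))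
    (X2s : ℕ → Fin (d + 1) → Fin (d + 1) → (Fin (d + 1) → ℤ) → Fin (d + 1) → (Fin (d + 1) → ℤ) → (Fin (d + 1) → ℤ) → Fib d → ℝ)
    (Δ : ℕ → Fin (d + 1) → Fin (d + 1) → (Fin (d + 1) → ℤ) → Fin (d + 1) → (Fin (d + 1) → ℤ) → MKer (d + 1) (Fib d))
    (hsplit : ∀ (j : ℕ) (α μ : Fin (d + 1)) (y : Fin (d + 1) → ℤ) (ν : Fin (d + 1)) (y' : Fin (d + 1) → ℤ),
      W2OfK (GcombSh (d := d) Lc j) Lc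
          (fun κ u => SpureRecOf d Lc V H (GcombSh Lc) cE cVH cΛ j κ u + conjV (bhKStepSh d Lc (Dsh Lc) j) (diagK fun p c => γ j * ctGenM d (bhK Lc + Dsh Lc) α Lc κ u p c))
          (M1Of d Lc H cΛ j)
          (fun κ u κ' u' => T2RecOf d Lc (GcombSh Lc) (SpureRecOf d Lc V H (GcombSh Lc) cE cVH cΛ) (M1Of d Lc H cΛ) cE₂ cB T vh₂S mixFF j κ u κ' u' +
            conjW (bhKStepSh d Lc (Dsh Lc) j) (SpureRecOf d Lc V H (GcombSh Lc) cE cVH cΛ j κ u) (SpureRecOf d Lc V H (GcombSh Lc) cE cVH cΛ j κ' u')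
              (diagK fun p c => γ j * ctGenM d (bhK Lc + Dsh Lc) α Lc κ u p c) (diagK fun p c => γ j * ctGenM d (bhK Lc + Dsh Lc) α Lc κ' u' p c) (diagK (h j α κ u κ' u')) +
            R2 j α κ u κ' u')
          (fun κ u ρ w => M2Of d Lc mixFF j κ u ρ w + conjV (M1Of d Lc H cΛ j ρ w) (diagK fun p c => γ j * ctGenM d (bhK Lc + Dsh Lc) α Lc κ u p c) + RM j α κ u ρ w)
          μ y ν y' =
        W2OfK (GcombSh (d := d) Lc j) Lc (SpureRecOf d Lc V H (GcombSh Lc) cE cVH cΛ j) (M1Of d Lc H cΛ j) (T2RecOf d Lc (GcombSh Lc) (SpureRecOf d Lc V H (GcombSh Lc) cE cVH cΛ) (M1Of d Lc H cΛ) cE₂ cB T vh₂S mixFF j) (M2Of d Lc mixFF j) μ y ν y' +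
          conjW (bhKStepSh d Lc (Dsh Lc) j)
            (dM (GcombSh Lc j) Lc (SpureRecOf d Lc V H (GcombSh Lc) cE cVH cΛ j) (M1Of d Lc H cΛ j) μ y) (dM (GcombSh Lc j) Lc (SpureRecOf d Lc V H (GcombSh Lc) cE cVH cΛ j) (M1Of d Lc H cΛ j) ν y')
            (diagK fun p c => ∑ κ, ∑' u, colH (GcombSh Lc j) Lc μ y κ u * (γ j * ctGenM d (bhK Lc + Dsh Lc) α Lc κ u p c)) (diagK fun p c => ∑ κ, ∑' u, colH (GcombSh Lc j) Lc ν y' κ u * (γ j * ctGenM d (bhK Lc + Dsh Lc) α Lc κ u p c))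
            (diagK (X2s j α μ y ν y')) +
          Δ j α μ y ν y')
    (hDg : ∀ (j : ℕ) (α ν : Fin (d + 1)) (y' : Fin (d + 1) → ℤ),
      Loc (dM (GcombSh (d := d) Lc j) Lc (fun κ u => SpureRecOf d Lc V H (GcombSh Lc) cE cVH cΛ j κ u + conjV (bhKStepSh d Lc (Dsh Lc) j) (diagK fun p c => γ j * ctGenM d (bhK Lc + Dsh Lc) α Lc κ u p c)) (M1Of d Lc H cΛ j) ν y'))
    (hX2L : ∀ j α μ y ν y', Loc (diagK (X2s j α μ y ν y'))) (hΔL : ∀ j α μ y ν y', Loc (Δ j α μ y ν y'))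
    (RB : ℕ → Fin (d + 1) → Fin (d + 1) → (Fin (d + 1) → ℤ) → Fin (d + 1) → (Fin (d + 1) → ℤ) → MKer (d + 1) (Fib d))
    (hRBff : ∀ j α κ u κ' u' (x z : Fin (d + 1) → ℤ) (β β' : Fin (d + 1)), RB j α κ u κ' u' x z (Sum.inl β) (Sum.inl β') = 0)
    (hBfm : ∀ (j : ℕ) (α : Fin (d + 1)) κ u κ' u' (x z : Fin (d + 1) → ℤ) (β m : Fin (d + 1)),
      ((cB * wB2 d Lc (j + 1)) • vh₂S κ (bref α κ u) κ' (bref α κ' u')) x z (Sum.inl β) (Sum.inr m) =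
        ((reflSign α κ * reflSign α κ') • refK (Φ Lc α) ((cB * wB2 d Lc (j + 1)) • vh₂S κ u κ' u' +
          conjW (bhKStepSh d Lc (Dsh Lc) (j + 1)) (SpureRecOf d Lc V H (GcombSh Lc) cE cVH cΛ (j + 1) κ u) (SpureRecOf d Lc V H (GcombSh Lc) cE cVH cΛ (j + 1) κ' u')
            (diagK fun p c => γ (j + 1) * ctGenM d (bhK Lc + Dsh Lc) α Lc κ u p c) (diagK fun p c => γ (j + 1) * ctGenM d (bhK Lc + Dsh Lc) α Lc κ' u' p c)
            (diagK (h (j + 1) α κ u κ' u')) + RB (j + 1) α κ u κ' u')) x z (Sum.inl β) (Sum.inr m))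
    (hBmf : ∀ (j : ℕ) (α : Fin (d + 1)) κ u κ' u' (x z : Fin (d + 1) → ℤ) (m β : Fin (d + 1)),
      ((cB * wB2 d Lc (j + 1)) • vh₂S κ (bref α κ u) κ' (bref α κ' u')) x z (Sum.inr m) (Sum.inl β) =
        ((reflSign α κ * reflSign α κ') • refK (Φ Lc α) ((cB * wB2 d Lc (j + 1)) • vh₂S κ u κ' u' +
          conjW (bhKStepSh d Lc (Dsh Lc) (j + 1)) (SpureRecOf d Lc V H (GcombSh Lc) cE cVH cΛ (j + 1) κ u) (SpureRecOf d Lc V H (GcombSh Lc) cE cVH cΛ (j + 1) κ' u')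
            (diagK fun p c => γ (j + 1) * ctGenM d (bhK Lc + Dsh Lc) α Lc κ u p c) (diagK fun p c => γ (j + 1) * ctGenM d (bhK Lc + Dsh Lc) α Lc κ' u' p c)
            (diagK (h (j + 1) α κ u κ' u')) + RB (j + 1) α κ u κ' u')) x z (Sum.inr m) (Sum.inl β))
    (hBmm : ∀ (j : ℕ) (α : Fin (d + 1)) κ u κ' u' (x z : Fin (d + 1) → ℤ) (m m' : Fin (d + 1)),
      ((cB * wB2 d Lc (j + 1)) • vh₂S κ (bref α κ u) κ' (bref α κ' u')) x z (Sum.inr m) (Sum.inr m') =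
        ((reflSign α κ * reflSign α κ') • refK (Φ Lc α) ((cB * wB2 d Lc (j + 1)) • vh₂S κ u κ' u' +
          conjW (bhKStepSh d Lc (Dsh Lc) (j + 1)) (SpureRecOf d Lc V H (GcombSh Lc) cE cVH cΛ (j + 1) κ u) (SpureRecOf d Lc V H (GcombSh Lc) cE cVH cΛ (j + 1) κ' u')
            (diagK fun p c => γ (j + 1) * ctGenM d (bhK Lc + Dsh Lc) α Lc κ u p c) (diagK fun p c => γ (j + 1) * ctGenM d (bhK Lc + Dsh Lc) α Lc κ' u' p c)
            (diagK (h (j + 1) α κ u κ' u')) + RB (j + 1) α κ u κ' u')) x z (Sum.inr m) (Sum.inr m'))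
    (hR2succ : ∀ (j : ℕ) (α κ : Fin (d + 1)) (u : Fin (d + 1) → ℤ) (κ' : Fin (d + 1)) (u' : Fin (d + 1) → ℤ),
      R2 (j + 1) α κ u κ' u' =
          (-((cE₂ * wV4 d Lc (j + 1)) • mmRead Lc
              (comp (comp (GcombSh Lc j) (((1 / 2 : ℝ) • conjV (bhKStepSh d Lc (Dsh Lc) j) (diagK fun p a => X2s j α κ' u' κ u p a - X2s j α κ u κ' u' p a) +
                (1 / 2 : ℝ) • (Δ j α κ u κ' u' + Δ j α κ' u' κ u)))) (GcombSh Lc j) -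
                (comp (sandwichDefect (GcombSh Lc j) (bhKStepSh d Lc (Dsh Lc) j)
                      (diagK fun p c => ∑ ι, ∑' v, colH (GcombSh Lc j) Lc κ u ι v * (γ j * ctGenM d (bhK Lc + Dsh Lc) α Lc ι v p c)))
                    (comp (dM (GcombSh Lc j) Lc (SpureRecOf d Lc V H (GcombSh Lc) cE cVH cΛ j) (M1Of d Lc H cΛ j) κ' u') (GcombSh Lc j) -
                      diagK fun p c => ∑ ι, ∑' v, colH (GcombSh Lc j) Lc κ' u' ι v * (γ j * ctGenM d (bhK Lc + Dsh Lc) α Lc ι v p c))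
                  + comp (comp (GcombSh Lc j) (dM (GcombSh Lc j) Lc (SpureRecOf d Lc V H (GcombSh Lc) cE cVH cΛ j) (M1Of d Lc H cΛ j) κ u +
                      conjV (bhKStepSh d Lc (Dsh Lc) j) (diagK fun p c => ∑ ι, ∑' v, colH (GcombSh Lc j) Lc κ u ι v * (γ j * ctGenM d (bhK Lc + Dsh Lc) α Lc ι v p c))))
                    (sandwichDefect (GcombSh Lc j) (bhKStepSh d Lc (Dsh Lc) j)
                      (diagK fun p c => ∑ ι, ∑' v, colH (GcombSh Lc j) Lc κ' u' ι v * (γ j * ctGenM d (bhK Lc + Dsh Lc) α Lc ι v p c)))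
                  + comp (sandwichDefect (GcombSh Lc j) (bhKStepSh d Lc (Dsh Lc) j)
                      (diagK fun p c => ∑ ι, ∑' v, colH (GcombSh Lc j) Lc κ' u' ι v * (γ j * ctGenM d (bhK Lc + Dsh Lc) α Lc ι v p c)))
                    (comp (dM (GcombSh Lc j) Lc (SpureRecOf d Lc V H (GcombSh Lc) cE cVH cΛ j) (M1Of d Lc H cΛ j) κ u) (GcombSh Lc j) -
                      diagK fun p c => ∑ ι, ∑' v, colH (GcombSh Lc j) Lc κ u ι v * (γ j * ctGenM d (bhK Lc + Dsh Lc) α Lc ι v p c))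
                  + comp (comp (GcombSh Lc j) (dM (GcombSh Lc j) Lc (SpureRecOf d Lc V H (GcombSh Lc) cE cVH cΛ j) (M1Of d Lc H cΛ j) κ' u' +
                      conjV (bhKStepSh d Lc (Dsh Lc) j) (diagK fun p c => ∑ ι, ∑' v, colH (GcombSh Lc j) Lc κ' u' ι v * (γ j * ctGenM d (bhK Lc + Dsh Lc) α Lc ι v p c))))
                    (sandwichDefect (GcombSh Lc j) (bhKStepSh d Lc (Dsh Lc) j)
                      (diagK fun p c => ∑ ι, ∑' v, colH (GcombSh Lc j) Lc κ u ι v * (γ j * ctGenM d (bhK Lc + Dsh Lc) α Lc ι v p c)))))) +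
            RB (j + 1) α κ u κ' u' +
            conjV (mmRead Lc (GcombSh (d := d) Lc j))
              (diagK fun p c => cE₂ * wV4 d Lc (j + 1) * mmSym Lc (X2s j α κ u κ' u') p c - wVH d Lc (j + 1) * h (j + 1) α κ u κ' u' p c))) :
    ∀ (j : ℕ) (α κ : Fin (d + 1)) (u : Fin (d + 1) → ℤ) (κ' : Fin (d + 1)) (u' : Fin (d + 1) → ℤ),
      T2RecOf d Lc (GcombSh Lc) (SpureRecOf d Lc V H (GcombSh Lc) cE cVH cΛ) (M1Of d Lc H cΛ) cE₂ cB T vh₂S mixFF j κ (bref α κ u) κ' (bref α κ' u') =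
        (reflSign α κ * reflSign α κ') • refK (Φ Lc α)
          (T2RecOf d Lc (GcombSh Lc) (SpureRecOf d Lc V H (GcombSh Lc) cE cVH cΛ) (M1Of d Lc H cΛ) cE₂ cB T vh₂S mixFF j κ u κ' u' +
            conjW (bhKStepSh d Lc (Dsh Lc) j) (SpureRecOf d Lc V H (GcombSh Lc) cE cVH cΛ j κ u) (SpureRecOf d Lc V H (GcombSh Lc) cE cVH cΛ j κ' u')
              (diagK fun p c => γ j * ctGenM d (bhK Lc + Dsh Lc) α Lc κ u p c) (diagK fun p c => γ j * ctGenM d (bhK Lc + Dsh Lc) α Lc κ' u' p c) (diagK (h j α κ u κ' u')) +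
            R2 j α κ u κ' u') := by
  intro j
  induction j with
  | zero => exact h0
  | succ j ih =>
    intro α κ u κ' u'
    have hW := WrecOf_bref_of_T2RM_comb hLc hHr cE cVH cΛ cE₂ cB T vh₂S mixFF γ j α (hSp j α) (h j α) (R2 j α) (RM j α) (ih α) (hM2 j α) (X2s j α)
      (Δ j α) (hsplit j α) (hDg j α)
    rw [hR2succ j α κ u κ' u']
    exact T2RecOf_succ_bref_of_laws_comb hLc hV hH hV0 hHr cE cVH cΛ cE₂ cB T hB2 hB0 hmix γ hlock hlock2 j α (hSp j α)
      (X2s j α) _ (hX2L j α) (loc_WRem_comb (hX2L j α) (hΔL j α)) hW (h (j + 1) α) (RB (j + 1) α) (hRBff (j + 1) α) (hBfm j α) (hBmf j α)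
      (hBmm j α) κ u κ' u'

end AllComb

end Summit.QuantumFields.BalabanUV.Beta.SpineRooted

end
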